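import Literature.AlgebraicGeometry.Motives.GrassmannianChartNatural
import Literature.AlgebraicGeometry.Motives.GrassmannianChartColumns
import Mathlib.CategoryTheory.Subfunctor.Basic
import HarnessLib

/-!
# The standard charts as subfunctors of `Module.Grassmannian.functor`, isomorphic to affine-space functors

Topic `Literature/AlgebraicGeometry/Motives`; namespace `Literature.AlgebraicGeometry.Motives`, prefix `Grassmannian.`.  Cell
hodgecm-mathlib key (h4) (author B-p21 (g15), partner B-p18 (g17)).  DEFINITIONS (functors / subfunctors / natural isomorphisms —
non-Prop plumbing over the ★ ring-side files `GrassmannianCharts` (C1)(C2), `GrassmannianChartAffine` (C4), `GrassmannianChartNatural`,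
`GrassmannianChartsCover` (C2′)(C5), `GrassmannianChartColumns`) + `rfl` lemmas only (statement-only lane); no instance, no notation,
no `sorry`.

This is Mathlib's TODO «define `chartFunctor x` to turn `chart x` into a subfunctor of `Module.Grassmannian.functor`; this will
correspond to an affine open chart in the Grassmannian» (`Mathlib/RingTheory/Grassmannian.lean`), in Mathlib's `Subfunctor` API:

* `Grassmannian.chartSubfunctor R M k x : Subfunctor (Module.Grassmannian.functor R M k)` — `A ↦ chart x A` (stable under the
  functor by ★ `map_mem_chart`); its functor `(chartSubfunctor …).toFunctor` and the mono `(chartSubfunctor …).ι` come from Mathlib;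
* `Grassmannian.coordMapsFunctor R M k x : CommAlgCat R ⥤ Type _` — `A ↦ {ψ : M →ₗ[R] Aᵏ // ψ(xᵢ) = eᵢ}`, `f ↦ (f ∘ ·)`;
* **`Grassmannian.chartSubfunctorIso x : (chartSubfunctor x).toFunctor ≅ coordMapsFunctor x`** — ★ `chartEquivCoordMaps` is natural
  (★ `coordMap_map`);
* `Grassmannian.columnsFunctor R k σ : CommAlgCat R ⥤ Type _` — the affine-space functor `A ↦ (σ → Aᵏ)`, and for a basis
  `b : J → M` (`J` in the universe of `M`) and `I : Fin k → J` injective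
  **`Grassmannian.coordMapsFunctorIsoColumns b I hI : coordMapsFunctor R M k (b ∘ I) ≅ columnsFunctor R k {j // j ∉ range I}`** —
  so the standard chart `U_I` of `G(k, M)`, `M` free, is functorially in the `R`-algebra the affine space `𝔸^{k · #(J ∖ I)}`
  ([Stacks 089T]; EGA I 9.7.4; [EisenbudHarris2016, §3.2.2]); the literal matrix case `M = Rⁿ` on points is ★
  `GrassmannianChartMatrix.bijective_chart_matrixCoord`;
* (the chart subfunctors cover the field-valued points: ★ `exists_mem_chart_of_field` ((C5), `GrassmannianChartsCover`)).

HC_CM is proved only modulo the 7 printed citations until rung 0 closes; nothing here is about HC.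

## References
* [StacksProject, Tag 089R and Tag 089T]; A. Grothendieck, EGA I (Springer 1971), §9.7.4; [EisenbudHarris2016, §3.2.2].
-/

noncomputable section

universe u v w

open TensorProduct CategoryTheory

namespace Literature.AlgebraicGeometry.Motives

namespace Grassmannian

variable (R : Type u) [CommRing R] (M : Type v) [AddCommGroup M] [Module R M] (k : ℕ)

/-! ## §1 The chart subfunctor -/

/-- **The standard chart at the frame `x` as a SUBFUNCTOR of Mathlib's Grassmannian functor** `A ↦ G(k, A ⊗ M; A)` on
`R`-algebras: `A ↦ chart x A`, stable under base change by ★ `map_mem_chart` (Mathlib's TODO «`chartFunctor x`»).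
[cite: StacksProject, Tag 089T] -/
def chartSubfunctor (x : Fin k → M) : Subfunctor (Module.Grassmannian.functor.{u, v, w} (R := R) (M := M) k) where
  obj A := chart R M k x A
  map f := fun _ hN => map_mem_chart f.hom hN

/-- Sections of the chart subfunctor are the chart. [cite: StacksProject, Tag 089T] -/
theorem chartSubfunctor_obj (x : Fin k → M) (A : CommAlgCat.{w} R) :
    (chartSubfunctor R M k x).obj A = chart R M k x A :=
  rfl

/-- The chart subfunctor acts by Mathlib's `Module.Grassmannian.map`. [cite: StacksProject, Tag 089T] -/
theorem chartSubfunctor_toFunctor_map_coe (x : Fin k → M) {A B : CommAlgCat.{w} R} (f : A ⟶ B)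
    (N : (chartSubfunctor R M k x).toFunctor.obj A) :
    ((chartSubfunctor R M k x).toFunctor.map f N).1 = Module.Grassmannian.map f.hom N.1 :=
  rfl

/-! ## §2 The functor of normalised coordinate maps and the natural isomorphism with the chart -/

/-- **The functor of coordinate maps** `A ↦ {ψ : M →ₗ[R] Aᵏ // ψ(xᵢ) = eᵢ}`, `f ↦ (ψ ↦ f ∘ ψ)` — for `M = Rⁿ`, `x = e ∘ I` the functor
of points of `𝔸^{k(n−k)}` on `R`-algebras (see `coordMapsFunctorIsoMatrix`). [cite: StacksProject, Tag 089T]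
[cite: EisenbudHarris2016, §3.2.2] -/
def coordMapsFunctor (x : Fin k → M) : CommAlgCat.{w} R ⥤ Type (max v w) where
  obj A := {ψ : M →ₗ[R] (Fin k → A) // ∀ i, ψ (x i) = Pi.single i 1}
  map f := TypeCat.ofHom fun ψ => ⟨f.hom.toLinearMap.compLeft (Fin k) ∘ₗ ψ.1, compLeft_comp_frame f.hom x ψ.1 ψ.2⟩
  map_id _ := ConcreteCategory.hom_ext _ _ fun _ => Subtype.ext (LinearMap.ext fun _ => rfl)
  map_comp _ _ := ConcreteCategory.hom_ext _ _ fun _ => Subtype.ext (LinearMap.ext fun _ => rfl)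

/-- The functor of coordinate maps acts by post-composition. [cite: StacksProject, Tag 089T] -/
theorem coordMapsFunctor_map_coe (x : Fin k → M) {A B : CommAlgCat.{w} R} (f : A ⟶ B)
    (ψ : (coordMapsFunctor R M k x).obj A) :
    ((coordMapsFunctor R M k x).map f ψ).1 = f.hom.toLinearMap.compLeft (Fin k) ∘ₗ ψ.1 :=
  rfl

/-- **THE CHART SUBFUNCTOR IS ISOMORPHIC TO THE FUNCTOR OF COORDINATE MAPS**: the bijections ★ `chartEquivCoordMaps x A`
(`N ↦ coordMap x N`) are natural in `A` (★ `coordMap_map`). [cite: StacksProject, Tag 089T] [cite: EisenbudHarris2016, §3.2.2] -/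
def chartSubfunctorIso (x : Fin k → M) : (chartSubfunctor R M k x).toFunctor ≅ coordMapsFunctor R M k x :=
  NatIso.ofComponents (fun A => (chartEquivCoordMaps R M k x A).toIso) fun {_ _} f =>
    ConcreteCategory.hom_ext _ _ fun N => Subtype.ext (coordMap_map f.hom x N.1 N.2)

/-- The isomorphism on sections is ★ `chartEquivCoordMaps`. [cite: StacksProject, Tag 089T] -/
theorem chartSubfunctorIso_hom_app_apply (x : Fin k → M) (A : CommAlgCat.{w} R)
    (N : (chartSubfunctor R M k x).toFunctor.obj A) :
    (chartSubfunctorIso R M k x).hom.app A N = chartEquivCoordMaps R M k x A N :=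
  rfl

/-! ## §3 `M` free with basis `b`, `x = b ∘ I`: the chart subfunctor is the affine space `A ↦ (J ∖ I → Aᵏ)` -/

/-- **The affine-space functor `A ↦ (σ → Aᵏ)`** on `R`-algebras (`f` acting entrywise); for `σ = J ∖ I` finite of size `n − k` this
is the functor of points of `𝔸^{k(n−k)}` on `R`-algebras. [cite: EisenbudHarris2016, §3.2.2] -/
def columnsFunctor (k : ℕ) (σ : Type v) : CommAlgCat.{w} R ⥤ Type (max v w) where
  obj A := σ → (Fin k → A)
  map f := TypeCat.ofHom fun v j => f.hom ∘ v j

/-- The affine-space functor acts entrywise. [cite: EisenbudHarris2016, §3.2.2] -/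
theorem columnsFunctor_map_apply (σ : Type v) {A B : CommAlgCat.{w} R} (f : A ⟶ B) (v : (columnsFunctor R k σ).obj A)
    (j : σ) : (columnsFunctor R k σ).map f v j = f.hom ∘ v j :=
  rfl

/-- **`U_I ≅ 𝔸^{k · #(J ∖ I)}` FUNCTORIALLY**: for a basis `b : J → M` of `M` (index type `J` in the universe of `M`) and
`I : Fin k → J` injective, the functor of coordinate maps of the frame `b ∘ I` is isomorphic to the affine-space functor
`A ↦ ({j // j ∉ range I} → Aᵏ)` by restriction to the non-`I` columns (★ `bijective_restrictColumns`, natural by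
`restrictColumns_compLeft`).  Composed with `chartSubfunctorIso` this identifies the chart subfunctor of `G(k, M)` at `b ∘ I` with an
affine space on `R`-algebras. [cite: EisenbudHarris2016, §3.2.2] [cite: StacksProject, Tag 089T] -/
def coordMapsFunctorIsoColumns {J : Type v} (b : Module.Basis J R M) (I : Fin k → J) (hI : Function.Injective I) :
    coordMapsFunctor R M k (⇑b ∘ I) ≅ columnsFunctor R k {j : J // j ∉ Set.range I} :=
  NatIso.ofComponents (fun A => (Equiv.ofBijective _ (bijective_restrictColumns A b I hI)).toIso)
    fun {_ _} _ => ConcreteCategory.hom_ext _ _ fun _ => rfl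

/-- The column isomorphism on sections: `ψ ↦ (j ↦ ψ(b_j))_{j ∉ I}`. [cite: EisenbudHarris2016, §3.2.2] -/
theorem coordMapsFunctorIsoColumns_hom_app_apply {J : Type v} (b : Module.Basis J R M) (I : Fin k → J)
    (hI : Function.Injective I) (A : CommAlgCat.{w} R) (ψ : (coordMapsFunctor R M k (⇑b ∘ I)).obj A)
    (j : {j : J // j ∉ Set.range I}) :
    (coordMapsFunctorIsoColumns R M k b I hI).hom.app A ψ j = ψ.1 (b j.1) :=
  rfl

/-- **THE CHART SUBFUNCTOR OF A FREE MODULE IS AN AFFINE SPACE**: `(chartSubfunctor (b ∘ I)).toFunctor ≅ (A ↦ (J ∖ I → Aᵏ))`,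
`N ↦ (coordMap N (b_j))_{j ∉ I}`. [cite: StacksProject, Tag 089T] [cite: EisenbudHarris2016, §3.2.2] -/
def chartSubfunctorIsoColumns {J : Type v} (b : Module.Basis J R M) (I : Fin k → J) (hI : Function.Injective I) :
    (chartSubfunctor R M k (⇑b ∘ I)).toFunctor ≅ columnsFunctor R k {j : J // j ∉ Set.range I} :=
  chartSubfunctorIso R M k (⇑b ∘ I) ≪≫ coordMapsFunctorIsoColumns R M k b I hI

/-- On sections: `N ↦ (coordMap_{b∘I} N (b_j))_{j ∉ I}`. [cite: StacksProject, Tag 089T] -/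
theorem chartSubfunctorIsoColumns_hom_app_apply {J : Type v} (b : Module.Basis J R M) (I : Fin k → J)
    (hI : Function.Injective I) (A : CommAlgCat.{w} R) (N : (chartSubfunctor R M k (⇑b ∘ I)).toFunctor.obj A)
    (j : {j : J // j ∉ Set.range I}) :
    (chartSubfunctorIsoColumns R M k b I hI).hom.app A N j = coordMap _ N.1 N.2 (b j.1) :=
  rfl

end Grassmannian

end Literature.AlgebraicGeometry.Motives

end
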